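import Summits.QuantumAdvantage.AdviceFreeQNC0.BlockAdditiveLanding
import HarnessLib

/-!
# Cell qa-qnc0 (rung F-Q1, crux α, line `product`): block-additive maps — exceptional moves, partners,
# the three-cycle, and ONE HALF of far-set balance with τ'' = 0 (qn-p1 TARGET §20.8, ask P6e)

Sixth file of the prover's τ''-free proof of `Sketch8b.BlockAdditiveFSB` (PROVER-MEMO-gen4 §2),
PROVED: `excSet` (type-1 moves with `bad(a) > k·4^L/24`) and `card_excSet_le` (Markov on
`card_badPairs_le`: `#E ≤ 72·k·2^L·#B`, `B = FAR_θ ∩ cls r`); `exists_common_partner` (`k ≥ 13`);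
`exists_cycle` (if `7776·#B < 2^L` some block carries a three-cycle of non-exceptional type-1 moves);
`cnorm_lt_of_not_mem_excSet` (`‖Δ‖ < 12θ·2^{L'}` off `E`); and
`blockAdditive_far_cls_succ_succ_le`: for `k ≥ 13` blocks of size `≥ 2`, block-local `G`, all `D, θ, r`:
**`#(FAR_{13θ} ∩ cls(r+2)) ≤ 8211·#(FAR_θ ∩ cls r)`** — the class-`(r+2)` half of far-set balance,
with NO slack τ''·2^L and ABSOLUTE `k₀ = 13`.  The class `r+1` half is the same argument for type-2
moves (or bit complementation) and the verbatim `Sketch8b.BlockAdditiveFSB` assembly (c = 13) is left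
to the next prover.  WHAT THIS IS NOT: nothing on FSB/FW at general column degree, nothing on α.
-/

noncomputable section

namespace Summit.QuantumAdvantage.AdviceFreeQNC0

open Finset
open Literature.Computability.MetaComplexity Literature.Computability.MetaComplexity.Smolensky

namespace BlockAdditive

variable {L L' k : ℕ}

section Half

open Classical

/-- Number of type-2 moves on other blocks forming a BAD pair with `a`. -/
def badCnt (blk : Fin L → Fin k) (G : Fin k → (Fin L → Bool) → (Fin L' → Bool) → Bool) (D : ℕ)
    (θ : ℝ) (a : Mv L k) : ℕ :=
  (univ.filter fun b : Mv L k => a.1 ≠ b.1 ∧ typ blk b 2 ∧ ¬ Good blk G D θ a b).card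

/-- The EXCEPTIONAL type-1 moves: too many bad partners. -/
def excSet (blk : Fin L → Fin k) (G : Fin k → (Fin L → Bool) → (Fin L' → Bool) → Bool) (D : ℕ)
    (θ : ℝ) : Finset (Mv L k) :=
  univ.filter fun a : Mv L k => typ blk a 1 ∧ (k : ℝ) * (4 : ℝ) ^ L / 24 < (badCnt blk G D θ a : ℝ)

/-- `Σ_a [type-1 a]·bad(a) = #BAD`. -/
theorem sum_badCnt_eq (blk : Fin L → Fin k) (G : Fin k → (Fin L → Bool) → (Fin L' → Bool) → Bool)
    (D : ℕ) (θ : ℝ) :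
    (∑ a ∈ univ.filter (fun a : Mv L k => typ blk a 1), (badCnt blk G D θ a : ℝ)) =
      ((univ.filter fun p : Mv L k × Mv L k =>
        p.1.1 ≠ p.2.1 ∧ typ blk p.1 1 ∧ typ blk p.2 2 ∧ ¬ Good blk G D θ p.1 p.2).card : ℝ) := by
  have h := card_filter_prod_eq_sum (fun (a b : Mv L k) =>
    a.1 ≠ b.1 ∧ typ blk a 1 ∧ typ blk b 2 ∧ ¬ Good blk G D θ a b)
  rw [h, Finset.sum_filter]
  push_cast
  refine Finset.sum_congr rfl fun a _ => ?_
  by_cases ha : typ blk a 1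
  · rw [if_pos ha]
    unfold badCnt
    congr 2
    exact Finset.filter_congr fun b _ => by simp [ha]
  · rw [if_neg ha]
    norm_cast
    rw [eq_comm, Finset.card_eq_zero, Finset.filter_eq_empty_iff]
    intro b _ hb
    exact ha hb.2.1

/-- **Markov**: `#E · (k·4^L/24) ≤ #BAD`, hence `#E ≤ 72·k·2^L·#B`. -/
theorem card_excSet_le (blk : Fin L → Fin k) (G : Fin k → (Fin L → Bool) → (Fin L' → Bool) → Bool)
    (D : ℕ) (θ : ℝ) (r : ℕ) (hk : 3 ≤ k)
    (hblk : ∀ i : Fin k, 2 ≤ (univ.filter fun j : Fin L => blk j = i).card) :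
    ((excSet blk G D θ).card : ℝ) ≤
      72 * k * (2 : ℝ) ^ L * ((far D (gammaBA G) θ ∩ cls L r).card : ℝ) := by
  set B := far D (gammaBA G) θ ∩ cls L r with hB
  have hbad := card_badPairs_le blk G D θ r hk hblk
  rw [← hB] at hbad
  have hM : ((excSet blk G D θ).card : ℝ) * ((k : ℝ) * (4 : ℝ) ^ L / 24) ≤
      ∑ a ∈ univ.filter (fun a : Mv L k => typ blk a 1), (badCnt blk G D θ a : ℝ) := by
    have hsub : excSet blk G D θ ⊆ univ.filter (fun a : Mv L k => typ blk a 1) := by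
      intro a ha
      unfold excSet at ha
      rw [Finset.mem_filter] at ha ⊢
      exact ⟨ha.1, ha.2.1⟩
    calc ((excSet blk G D θ).card : ℝ) * ((k : ℝ) * (4 : ℝ) ^ L / 24)
        = ∑ _a ∈ excSet blk G D θ, (k : ℝ) * (4 : ℝ) ^ L / 24 := by
          rw [Finset.sum_const, nsmul_eq_mul]
      _ ≤ ∑ a ∈ excSet blk G D θ, (badCnt blk G D θ a : ℝ) := by
          refine Finset.sum_le_sum fun a ha => ?_
          unfold excSet at ha
          exact (Finset.mem_filter.1 ha).2.2.le
      _ ≤ ∑ a ∈ univ.filter (fun a : Mv L k => typ blk a 1), (badCnt blk G D θ a : ℝ) :=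
          Finset.sum_le_sum_of_subset_of_nonneg hsub fun _ _ _ => by positivity
  rw [sum_badCnt_eq] at hM
  have h4 : (4 : ℝ) ^ L = (2 : ℝ) ^ L * (2 : ℝ) ^ L := by
    rw [← mul_pow]; norm_num
  have h2L : (0 : ℝ) < (2 : ℝ) ^ L := by positivity
  have hk0 : (0 : ℝ) < k := by exact_mod_cast (by omega : 0 < k)
  have hbad' : ((univ.filter fun p : Mv L k × Mv L k =>
        p.1.1 ≠ p.2.1 ∧ typ blk p.1 1 ∧ typ blk p.2 2 ∧ ¬ Good blk G D θ p.1 p.2).card : ℝ) ≤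
      3 * (k : ℝ) ^ 2 * ((2 : ℝ) ^ L * (2 : ℝ) ^ L * (2 : ℝ) ^ L) * (B.card : ℝ) := by
    have := hbad
    have e : 12 * ((k : ℝ) ^ 2 * (((2 : ℝ) ^ L / 2) ^ 2 * ((2 : ℝ) ^ L * (2 : ℝ) ^ L * (B.card : ℝ)))) =
        (3 * (k : ℝ) ^ 2 * ((2 : ℝ) ^ L * (2 : ℝ) ^ L * (2 : ℝ) ^ L) * (B.card : ℝ)) * (2 : ℝ) ^ L := by
      ring
    rw [e] at this
    exact le_of_mul_le_mul_right this h2L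
  rw [h4] at hM
  have hE := hM.trans hbad'
  have : ((excSet blk G D θ).card : ℝ) * ((k : ℝ) * ((2 : ℝ) ^ L * (2 : ℝ) ^ L) / 24) ≤
      (72 * k * (2 : ℝ) ^ L * (B.card : ℝ)) * ((k : ℝ) * ((2 : ℝ) ^ L * (2 : ℝ) ^ L) / 24) := by
    calc _ ≤ 3 * (k : ℝ) ^ 2 * ((2 : ℝ) ^ L * (2 : ℝ) ^ L * (2 : ℝ) ^ L) * (B.card : ℝ) := hE
      _ = (72 * k * (2 : ℝ) ^ L * (B.card : ℝ)) * ((k : ℝ) * ((2 : ℝ) ^ L * (2 : ℝ) ^ L) / 24) := by ring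
  exact le_of_mul_le_mul_right this (by positivity)

/-- Type-2 moves on one block are at most `2^L·2^L/2`. -/
theorem card_typ_two_block_le (blk : Fin L → Fin k)
    (hblk : ∀ i : Fin k, 2 ≤ (univ.filter fun j : Fin L => blk j = i).card) (i : Fin k) :
    2 * ((univ.filter fun b : Mv L k => b.1 = i ∧ typ blk b 2).card : ℝ) ≤ (2 : ℝ) ^ L * (2 : ℝ) ^ L := by
  rw [card_filter_prod_eq_sum (fun (j : Fin k) (xy : (Fin L → Bool) × (Fin L → Bool)) =>
    j = i ∧ typ blk (j, xy.1, xy.2) 2)]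
  rw [Finset.sum_eq_single i]
  · rw [card_filter_prod_eq_sum (fun (x y : Fin L → Bool) => i = i ∧ typ blk (i, x, y) 2)]
    push_cast
    rw [Finset.mul_sum]
    calc (∑ x : Fin L → Bool, 2 * (((univ.filter fun y : Fin L → Bool => i = i ∧ typ blk (i, x, y) 2).card
          : ℕ) : ℝ)) ≤ ∑ _x : Fin L → Bool, (2 : ℝ) ^ L := by
          refine Finset.sum_le_sum fun x _ => ?_
          have e : (univ.filter fun y : Fin L → Bool => i = i ∧ typ blk (i, x, y) 2) =
              univ.filter fun y : Fin L → Bool => typ blk (i, x, y) 2 :=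
            Finset.filter_congr fun y _ => by simp
          rw [e]; exact card_typ_le blk hblk i x 2
      _ = (2 : ℝ) ^ L * (2 : ℝ) ^ L := by
          rw [Finset.sum_const, Finset.card_univ, Fintype.card_fun, Fintype.card_bool, Fintype.card_fin,
            nsmul_eq_mul]; push_cast; ring
  · intro j _ hj
    rw [Finset.card_eq_zero, Finset.filter_eq_empty_iff]
    intro xy _ h; exact hj h.1
  · intro h; exact absurd (Finset.mem_univ i) h

/-- Type-2 moves in total are at least `k·2^L·2^L/6`. -/
theorem card_typ_two_ge (blk : Fin L → Fin k)
    (hblk : ∀ i : Fin k, 2 ≤ (univ.filter fun j : Fin L => blk j = i).card) :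
    (k : ℝ) * ((2 : ℝ) ^ L * (2 : ℝ) ^ L) ≤ 6 * ((univ.filter fun b : Mv L k => typ blk b 2).card : ℝ) := by
  rw [card_filter_prod_eq_sum (fun (j : Fin k) (xy : (Fin L → Bool) × (Fin L → Bool)) =>
    typ blk (j, xy.1, xy.2) 2)]
  push_cast
  rw [Finset.mul_sum]
  calc (k : ℝ) * ((2 : ℝ) ^ L * (2 : ℝ) ^ L) = ∑ _j : Fin k, (2 : ℝ) ^ L * (2 : ℝ) ^ L := by
        rw [Finset.sum_const, Finset.card_univ, Fintype.card_fin, nsmul_eq_mul]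
    _ ≤ ∑ j : Fin k, 6 * (((univ.filter fun xy : (Fin L → Bool) × (Fin L → Bool) =>
          typ blk (j, xy.1, xy.2) 2).card : ℕ) : ℝ) := by
        refine Finset.sum_le_sum fun j _ => ?_
        rw [card_filter_prod_eq_sum (fun (x y : Fin L → Bool) => typ blk (j, x, y) 2)]
        push_cast
        rw [Finset.mul_sum]
        calc (2 : ℝ) ^ L * (2 : ℝ) ^ L = ∑ _x : Fin L → Bool, (2 : ℝ) ^ L := by
              rw [Finset.sum_const, Finset.card_univ, Fintype.card_fun, Fintype.card_bool, Fintype.card_fin,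
                nsmul_eq_mul]; push_cast; ring
          _ ≤ _ := Finset.sum_le_sum fun x _ => card_typ_ge blk hblk j x 2

/-- **Common partner** (`k ≥ 13`): two non-exceptional type-1 moves share a good type-2 partner. -/
theorem exists_common_partner (blk : Fin L → Fin k)
    (G : Fin k → (Fin L → Bool) → (Fin L' → Bool) → Bool) (D : ℕ) (θ : ℝ) (hk : 13 ≤ k)
    (hblk : ∀ i : Fin k, 2 ≤ (univ.filter fun j : Fin L => blk j = i).card)
    {a a' : Mv L k} (ha : typ blk a 1) (ha' : typ blk a' 1)
    (hea : a ∉ excSet blk G D θ) (hea' : a' ∉ excSet blk G D θ) :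
    ∃ b : Mv L k, typ blk b 2 ∧ a.1 ≠ b.1 ∧ a'.1 ≠ b.1 ∧ Good blk G D θ a b ∧ Good blk G D θ a' b := by
  have hba : (badCnt blk G D θ a : ℝ) ≤ (k : ℝ) * (4 : ℝ) ^ L / 24 := by
    by_contra h
    push Not at h
    exact hea (by unfold excSet; rw [Finset.mem_filter]; exact ⟨Finset.mem_univ _, ha, h⟩)
  have hba' : (badCnt blk G D θ a' : ℝ) ≤ (k : ℝ) * (4 : ℝ) ^ L / 24 := by
    by_contra h
    push Not at h
    exact hea' (by unfold excSet; rw [Finset.mem_filter]; exact ⟨Finset.mem_univ _, ha', h⟩)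
  set P := univ.filter fun b : Mv L k => typ blk b 2 ∧ a.1 ≠ b.1 ∧ a'.1 ≠ b.1 with hP
  set Q := univ.filter fun b : Mv L k =>
      typ blk b 2 ∧ a.1 ≠ b.1 ∧ a'.1 ≠ b.1 ∧ Good blk G D θ a b ∧ Good blk G D θ a' b with hQ
  have hPcard : ((univ.filter fun b : Mv L k => typ blk b 2).card : ℝ) ≤
      (P.card : ℝ) + ((univ.filter fun b : Mv L k => b.1 = a.1 ∧ typ blk b 2).card : ℝ) +
        ((univ.filter fun b : Mv L k => b.1 = a'.1 ∧ typ blk b 2).card : ℝ) := by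
    have hsub : (univ.filter fun b : Mv L k => typ blk b 2) ⊆
        (P ∪ (univ.filter fun b : Mv L k => b.1 = a.1 ∧ typ blk b 2)) ∪
          (univ.filter fun b : Mv L k => b.1 = a'.1 ∧ typ blk b 2) := by
      intro b hb
      rw [Finset.mem_filter] at hb
      rw [Finset.mem_union, Finset.mem_union, hP, Finset.mem_filter, Finset.mem_filter, Finset.mem_filter]
      by_cases h1 : b.1 = a.1
      · exact Or.inl (Or.inr ⟨Finset.mem_univ _, h1, hb.2⟩)
      · by_cases h2 : b.1 = a'.1
        · exact Or.inr ⟨Finset.mem_univ _, h2, hb.2⟩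
        · exact Or.inl (Or.inl ⟨Finset.mem_univ _, hb.2, Ne.symm h1, Ne.symm h2⟩)
    have := (Finset.card_le_card hsub).trans
      ((Finset.card_union_le _ _).trans (Nat.add_le_add_right (Finset.card_union_le _ _) _))
    exact_mod_cast this
  have hQcard : (P.card : ℝ) ≤ (Q.card : ℝ) + (badCnt blk G D θ a : ℝ) + (badCnt blk G D θ a' : ℝ) := by
    have hsub : P ⊆ (Q ∪ (univ.filter fun b : Mv L k => a.1 ≠ b.1 ∧ typ blk b 2 ∧ ¬ Good blk G D θ a b)) ∪
        (univ.filter fun b : Mv L k => a'.1 ≠ b.1 ∧ typ blk b 2 ∧ ¬ Good blk G D θ a' b) := by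
      intro b hb
      rw [hP, Finset.mem_filter] at hb
      rw [Finset.mem_union, Finset.mem_union, hQ, Finset.mem_filter, Finset.mem_filter, Finset.mem_filter]
      by_cases g1 : Good blk G D θ a b
      · by_cases g2 : Good blk G D θ a' b
        · exact Or.inl (Or.inl ⟨Finset.mem_univ _, hb.2.1, hb.2.2.1, hb.2.2.2, g1, g2⟩)
        · exact Or.inr ⟨Finset.mem_univ _, hb.2.2.2, hb.2.1, g2⟩
      · exact Or.inl (Or.inr ⟨Finset.mem_univ _, hb.2.2.1, hb.2.1, g1⟩)
    have := (Finset.card_le_card hsub).trans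
      ((Finset.card_union_le _ _).trans (Nat.add_le_add_right (Finset.card_union_le _ _) _))
    unfold badCnt
    exact_mod_cast this
  have h1 := card_typ_two_ge blk hblk
  have h2 := card_typ_two_block_le blk hblk a.1
  have h3 := card_typ_two_block_le blk hblk a'.1
  have h4L : (4 : ℝ) ^ L = (2 : ℝ) ^ L * (2 : ℝ) ^ L := by rw [← mul_pow]; norm_num
  rw [h4L] at hba hba'
  have hk' : (13 : ℝ) ≤ k := by exact_mod_cast hk
  have hpos : (0 : ℝ) < (2 : ℝ) ^ L * (2 : ℝ) ^ L := by positivity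
  have hQpos : (0 : ℝ) < (Q.card : ℝ) := by nlinarith
  have hQne : Q.Nonempty := by
    rw [← Finset.card_pos]; exact_mod_cast hQpos
  obtain ⟨b, hb⟩ := hQne
  rw [hQ, Finset.mem_filter] at hb
  exact ⟨b, hb.2.1, hb.2.2.1, hb.2.2.2.1, hb.2.2.2.2.1, hb.2.2.2.2.2⟩

/-- **Three-cycle existence**: if `7776·#B < 2^L` some block carries a non-exceptional `x → y → z → x`. -/
theorem exists_cycle (blk : Fin L → Fin k) (G : Fin k → (Fin L → Bool) → (Fin L' → Bool) → Bool)
    (D : ℕ) (θ : ℝ) (r : ℕ) (hk : 3 ≤ k)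
    (hblk : ∀ i : Fin k, 2 ≤ (univ.filter fun j : Fin L => blk j = i).card)
    (hB : 7776 * ((far D (gammaBA G) θ ∩ cls L r).card : ℝ) < (2 : ℝ) ^ L) :
    ∃ i : Fin k, ∃ x y z : Fin L → Bool, typ blk (i, x, y) 1 ∧ typ blk (i, y, z) 1 ∧ typ blk (i, z, x) 1 ∧
      (i, x, y) ∉ excSet blk G D θ ∧ (i, y, z) ∉ excSet blk G D θ ∧ (i, z, x) ∉ excSet blk G D θ := by
  set E := excSet blk G D θ with hE
  have hEcard := card_excSet_le blk G D θ r hk hblk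
  rw [← hE] at hEcard
  set CYC := univ.filter fun q : Mv L k × (Fin L → Bool) =>
      typ blk q.1 1 ∧ typ blk (q.1.1, q.1.2.2, q.2) 1 with hCYC
  have hlow : (k : ℝ) * ((2 : ℝ) ^ L * (2 : ℝ) ^ L * (2 : ℝ) ^ L) ≤ 36 * (CYC.card : ℝ) := by
    rw [hCYC, card_filter_prod_eq_sum (fun (m : Mv L k) (z : Fin L → Bool) =>
      typ blk m 1 ∧ typ blk (m.1, m.2.2, z) 1)]
    push_cast
    have hm : ∀ m : Mv L k, (if typ blk m 1 then (1 : ℝ) else 0) * (2 : ℝ) ^ L ≤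
        6 * (((univ.filter fun z : Fin L → Bool => typ blk m 1 ∧ typ blk (m.1, m.2.2, z) 1).card : ℕ) : ℝ) := by
      intro m
      by_cases ht : typ blk m 1
      · rw [if_pos ht, one_mul]
        have e : (univ.filter fun z : Fin L → Bool => typ blk m 1 ∧ typ blk (m.1, m.2.2, z) 1) =
            univ.filter fun z : Fin L → Bool => typ blk (m.1, m.2.2, z) 1 :=
          Finset.filter_congr fun z _ => by simp [ht]
        rw [e]; exact card_typ_ge blk hblk m.1 m.2.2 1
      · rw [if_neg ht]; simp only [zero_mul]; positivity
    have hM1 : (k : ℝ) * ((2 : ℝ) ^ L * (2 : ℝ) ^ L) ≤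
        6 * ∑ m : Mv L k, (if typ blk m 1 then (1 : ℝ) else 0) := by
      rw [Finset.sum_boole]
      rw [card_filter_prod_eq_sum (fun (j : Fin k) (xy : (Fin L → Bool) × (Fin L → Bool)) =>
        typ blk (j, xy.1, xy.2) 1)]
      push_cast
      rw [Finset.mul_sum]
      calc (k : ℝ) * ((2 : ℝ) ^ L * (2 : ℝ) ^ L) = ∑ _j : Fin k, (2 : ℝ) ^ L * (2 : ℝ) ^ L := by
            rw [Finset.sum_const, Finset.card_univ, Fintype.card_fin, nsmul_eq_mul]
        _ ≤ ∑ j : Fin k, 6 * (((univ.filter fun xy : (Fin L → Bool) × (Fin L → Bool) =>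
              typ blk (j, xy.1, xy.2) 1).card : ℕ) : ℝ) := by
            refine Finset.sum_le_sum fun j _ => ?_
            rw [card_filter_prod_eq_sum (fun (x y : Fin L → Bool) => typ blk (j, x, y) 1)]
            push_cast
            rw [Finset.mul_sum]
            calc (2 : ℝ) ^ L * (2 : ℝ) ^ L = ∑ _x : Fin L → Bool, (2 : ℝ) ^ L := by
                  rw [Finset.sum_const, Finset.card_univ, Fintype.card_fun, Fintype.card_bool,
                    Fintype.card_fin, nsmul_eq_mul]; push_cast; ring
              _ ≤ _ := Finset.sum_le_sum fun x _ => card_typ_ge blk hblk j x 1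
    calc (k : ℝ) * ((2 : ℝ) ^ L * (2 : ℝ) ^ L * (2 : ℝ) ^ L)
        = (k : ℝ) * ((2 : ℝ) ^ L * (2 : ℝ) ^ L) * (2 : ℝ) ^ L := by ring
      _ ≤ (6 * ∑ m : Mv L k, (if typ blk m 1 then (1 : ℝ) else 0)) * (2 : ℝ) ^ L :=
          mul_le_mul_of_nonneg_right hM1 (by positivity)
      _ = 6 * ∑ m : Mv L k, (if typ blk m 1 then (1 : ℝ) else 0) * (2 : ℝ) ^ L := by
          rw [mul_assoc, Finset.sum_mul]
      _ ≤ 6 * ∑ m : Mv L k, 6 * (((univ.filter fun z : Fin L → Bool =>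
            typ blk m 1 ∧ typ blk (m.1, m.2.2, z) 1).card : ℕ) : ℝ) :=
          mul_le_mul_of_nonneg_left (Finset.sum_le_sum fun m _ => hm m) (by norm_num)
      _ = 36 * ∑ m : Mv L k, (((univ.filter fun z : Fin L → Bool =>
            typ blk m 1 ∧ typ blk (m.1, m.2.2, z) 1).card : ℕ) : ℝ) := by
          rw [Finset.mul_sum, Finset.mul_sum]
          refine Finset.sum_congr rfl fun m _ => by ring
  set C1 := univ.filter fun q : Mv L k × (Fin L → Bool) => q.1 ∈ E with hC1
  set C2 := univ.filter fun q : Mv L k × (Fin L → Bool) => (q.1.1, q.1.2.2, q.2) ∈ E with hC2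
  set C3 := univ.filter fun q : Mv L k × (Fin L → Bool) => (q.1.1, q.2, q.1.2.1) ∈ E with hC3
  have hC1card : C1.card ≤ E.card * 2 ^ L := by
    have : C1 = E ×ˢ (univ : Finset (Fin L → Bool)) := by
      ext q; rw [hC1, Finset.mem_filter, Finset.mem_product]; simp
    rw [this, Finset.card_product, Finset.card_univ, Fintype.card_fun, Fintype.card_bool, Fintype.card_fin]
  have hC2card : C2.card ≤ E.card * 2 ^ L := by
    have h := Finset.card_le_card_of_injOn (s := C2) (t := E ×ˢ (univ : Finset (Fin L → Bool)))
      (fun q => ((q.1.1, q.1.2.2, q.2), q.1.2.1)) (fun q hq => by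
        rw [Finset.mem_coe, hC2, Finset.mem_filter] at hq
        rw [Finset.mem_coe, Finset.mem_product]
        exact ⟨hq.2, Finset.mem_univ _⟩) (by
        intro q _ q' _ h
        simp only [Prod.mk.injEq] at h
        obtain ⟨⟨h1, h2, h3⟩, h4⟩ := h
        exact Prod.ext (Prod.ext h1 (Prod.ext h4 h2)) h3)
    rwa [Finset.card_product, Finset.card_univ, Fintype.card_fun, Fintype.card_bool, Fintype.card_fin] at h
  have hC3card : C3.card ≤ E.card * 2 ^ L := by
    have h := Finset.card_le_card_of_injOn (s := C3) (t := E ×ˢ (univ : Finset (Fin L → Bool)))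
      (fun q => ((q.1.1, q.2, q.1.2.1), q.1.2.2)) (fun q hq => by
        rw [Finset.mem_coe, hC3, Finset.mem_filter] at hq
        rw [Finset.mem_coe, Finset.mem_product]
        exact ⟨hq.2, Finset.mem_univ _⟩) (by
        intro q _ q' _ h
        simp only [Prod.mk.injEq] at h
        obtain ⟨⟨h1, h2, h3⟩, h4⟩ := h
        exact Prod.ext (Prod.ext h1 (Prod.ext h3 h4)) h2)
    rwa [Finset.card_product, Finset.card_univ, Fintype.card_fun, Fintype.card_bool, Fintype.card_fin] at h
  by_contra hnone
  push Not at hnone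
  have hsub : CYC ⊆ (C1 ∪ C2) ∪ C3 := by
    intro q hq
    rw [hCYC, Finset.mem_filter] at hq
    obtain ⟨_, h1, h2⟩ := hq
    have h3 : typ blk (q.1.1, q.2, q.1.2.1) 1 := by
      unfold typ at h1 h2 ⊢; simp only at h1 h2 ⊢; omega
    rw [Finset.mem_union, Finset.mem_union, hC1, hC2, hC3, Finset.mem_filter, Finset.mem_filter,
      Finset.mem_filter]
    have h1' : typ blk (q.1.1, q.1.2.1, q.1.2.2) 1 := h1
    have := hnone q.1.1 q.1.2.1 q.1.2.2 q.2 h1' h2 h3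
    by_cases e1 : (q.1.1, q.1.2.1, q.1.2.2) ∈ E
    · exact Or.inl (Or.inl ⟨Finset.mem_univ _, e1⟩)
    · by_cases e2 : (q.1.1, q.1.2.2, q.2) ∈ E
      · exact Or.inl (Or.inr ⟨Finset.mem_univ _, e2⟩)
      · exact Or.inr ⟨Finset.mem_univ _, this e1 e2⟩
  have hcard := (Finset.card_le_card hsub).trans
    ((Finset.card_union_le _ _).trans (Nat.add_le_add_right (Finset.card_union_le _ _) _))
  have hcard' : (CYC.card : ℝ) ≤ 3 * ((E.card : ℝ) * (2 : ℝ) ^ L) := by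
    have : CYC.card ≤ 3 * (E.card * 2 ^ L) := by omega
    exact_mod_cast this
  have hk0 : (0 : ℝ) < k := by exact_mod_cast (by omega : 0 < k)
  have h2L : (0 : ℝ) < (2 : ℝ) ^ L := by positivity
  nlinarith [hlow, hcard', hEcard, hB, mul_pos hk0 h2L, mul_pos (mul_pos hk0 h2L) h2L]

/-- **Non-exceptional type-1 moves have small increments** (`7776·#B < 2^L`, `k ≥ 13`). -/
theorem cnorm_lt_of_not_mem_excSet (blk : Fin L → Fin k)
    (G : Fin k → (Fin L → Bool) → (Fin L' → Bool) → Bool) (hG : BlockLocal blk G) (D : ℕ) (θ : ℝ)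
    (r : ℕ) (hk : 13 ≤ k) (hblk : ∀ i : Fin k, 2 ≤ (univ.filter fun j : Fin L => blk j = i).card)
    (hB : 7776 * ((far D (gammaBA G) θ ∩ cls L r).card : ℝ) < (2 : ℝ) ^ L)
    {m : Mv L k} (hm : typ blk m 1) (hme : m ∉ excSet blk G D θ) :
    (cnorm D (incrM G m) : ℝ) < 12 * θ * (2 : ℝ) ^ L' := by
  obtain ⟨i, x, y, z, t1, t2, t3, e1, e2, e3⟩ := exists_cycle blk G D θ r (by omega) hblk hB
  obtain ⟨b₁, _, hb₁, hb₁', g₁, g₁'⟩ := exists_common_partner blk G D θ hk hblk hm t1 hme e1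
  obtain ⟨b₂, _, hb₂, hb₂', g₂, g₂'⟩ := exists_common_partner blk G D θ hk hblk hm t2 hme e2
  obtain ⟨b₃, _, hb₃, hb₃', g₃, g₃'⟩ := exists_common_partner blk G D θ hk hblk hm t3 hme e3
  exact cnorm_lt_of_cycle_partners hG m i x y z b₁ b₂ b₃ hb₁ hb₂ hb₃ hb₁' hb₂' hb₃' g₁ g₁' g₂ g₂' g₃ g₃'

/-- **ONE HALF OF FAR-SET BALANCE FOR BLOCK-ADDITIVE MAPS, τ'' = 0** (class `r + 2`, ratio `13`):
`#(FAR_{13θ} ∩ cls(r+2)) ≤ 8211 · #(FAR_θ ∩ cls r)` for `k ≥ 13` blocks of size `≥ 2`. -/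
theorem blockAdditive_far_cls_succ_succ_le (blk : Fin L → Fin k)
    (G : Fin k → (Fin L → Bool) → (Fin L' → Bool) → Bool) (hG : BlockLocal blk G) (hk : 13 ≤ k)
    (hblk : ∀ i : Fin k, 2 ≤ (univ.filter fun j : Fin L => blk j = i).card)
    (D : ℕ) (θ : ℝ) (r : ℕ) :
    ((far D (gammaBA G) (13 * θ) ∩ cls L (r + 2)).card : ℝ) ≤
      8211 * ((far D (gammaBA G) θ ∩ cls L r).card : ℝ) := by
  set B := far D (gammaBA G) θ ∩ cls L r with hB
  by_cases hX : 7776 * (B.card : ℝ) < (2 : ℝ) ^ L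
  · -- the main case
    have hsmall : ∀ m : Mv L k, typ blk m 1 → m ∉ excSet blk G D θ →
        (cnorm D (incrM G m) : ℝ) < (13 - 1) * θ * (2 : ℝ) ^ L' := by
      intro m hm hme
      have := cnorm_lt_of_not_mem_excSet blk G hG D θ r hk hblk (by rw [← hB]; exact hX) hm hme
      linarith
    have hland := card_far_cls_succ_succ_le blk G hG hblk D θ 13 r (excSet blk G D θ) hsmall
    have hE := card_excSet_le blk G D θ r (by omega) hblk
    rw [← hB] at hland hE
    have hk0 : (0 : ℝ) < k := by exact_mod_cast (by omega : 0 < k)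
    have h2L : (0 : ℝ) < (2 : ℝ) ^ L := by positivity
    have : ((far D (gammaBA G) (13 * θ) ∩ cls L (r + 2)).card : ℝ) * (k * (2 : ℝ) ^ L) ≤
        (435 * (B.card : ℝ)) * (k * (2 : ℝ) ^ L) := by nlinarith
    have h435 := le_of_mul_le_mul_right this (by positivity)
    linarith [show (0 : ℝ) ≤ (B.card : ℝ) by positivity]
  · -- B is large: trivial
    push Not at hX
    have hF : ((far D (gammaBA G) (13 * θ) ∩ cls L (r + 2)).card : ℝ) ≤ (2 : ℝ) ^ L := by
      have : (far D (gammaBA G) (13 * θ) ∩ cls L (r + 2)).card ≤ 2 ^ L := by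
        calc _ ≤ (univ : Finset (Fin L → Bool)).card := Finset.card_le_card (Finset.subset_univ _)
          _ = 2 ^ L := by rw [Finset.card_univ, Fintype.card_fun, Fintype.card_bool, Fintype.card_fin]
      exact_mod_cast this
    linarith

end Half

end BlockAdditive

end Summit.QuantumAdvantage.AdviceFreeQNC0

end
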